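import Literature.AnabelianGeometry.SemiGraphs.PSCTwoComponentShape
import Literature.AnabelianGeometry.SemiGraphs.PSCThm16iiiHypothesisFreeProofs
import Literature.AnabelianGeometry.SemiGraphs.PSCThm16iiGeneralSigmaProofs
import HarnessLib

/-!
# [CombGC] Theorem 1.6 (ii)(iii) for general `Σ`: a NON-VACUITY witness at `Σ = {2, 3}` and two vertices

Mochizuki, *A combinatorial version of the Grothendieck conjecture* [CombGC], Tohoku Math. J. **59**
(2007), §1, Theorem 1.6 (ii)(iii), author's manuscript p. 13 [cite: MochizukiCombGC2007, Thm 1.6 p.13],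
proof of (i) p. 13 ("we may assume without loss of generality that `Σ = {l}`"; for (ii)/(iii) by the
cross-reference "as in the proof of assertion (i)", p. 14).

The cell's general-`Σ` kernels of Theorem 1.6 — (iii) `unrVerticialIff_holds_of_common_prime'` /
`unrVerticialIffHolds_of_inputs''` (`PSCThm16iiiGeneralSigmaProofs`, `PSCThm16iiiHypothesisFreeProofs`)
and (ii) `graphicIffFiltrationPreservingHolds_of_inputs''` (`PSCThm16iiGeneralSigmaProofs`) — derive
the typed rows F-0461 / F-0444 for ALL `Ω`-data on profinite groups and EVERY `Σ` from the named
origin statements.  Their honest reading requires that the quantifier domain in which the `Σ = {l}`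
reduction actually does work — data with `Σ ⊋ {l}` and MORE THAN ONE vertex (so that the verticial /
unramified-verticial clauses are not vacuous), STURDY (so that the conclusion of (iii),
`IsSturdy → IsSturdy → (… ↔ …)`, is a genuine `↔`) — is inhabited by GENUINE data of an origin `Ω`
all of whose data are profinite (the displayed `hprof`).

This PROOF-ONLY file (no definitions) records such a witness, cell row «PSC-NV-Σ» (abc-iut-L3-lead
α112): the origin `Ω_tc'` of data of TWO-COMPONENT SHAPE — what Def. 1.1 extracts from a stable curve
with two smooth components meeting at one node, in the displayed form of abc-iut-f-165's
`exists_twoComponentOrigin_holds` (`PSCTwoComponentShape.lean`): along a pro-`Σ` completion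
`ι : Γ_{g₁+g₂,0} → Π` the two verticial groups are the closures of the handle groups, the node group is
the closure of the vanishing cycle — is inhabited, for `Σ = {2, 3}` and `g₁ = g₂ = 2`, by a STURDY datum
with `i = 2`, `n = 1`, `r = 0` on a profinite group (`generalSigma_scope_inhabited`); and at that datum
the two general-`Σ` theorems instantiate BY NAME (`generalSigma_nonVacuity`): modulo the origin
statements at `Ω_tc'` (displayed as hypotheses, exactly the inputs of the cited kernels — nothing is
asserted about them here), EVERY `β : Π^unr ≃ Π^unr` is verticially filtration-preserving iff
group-theoretically verticial, and EVERY `α : Π ≃ Π` is graphic iff graphically filtration-preserving —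
with `l = 2` and `l = 3` both available as the common prime.  Consistency / non-vacuity evidence for the
typed schema; NOT the printed theorem for all pointed stable curves; nothing here takes a side on
[IUTchIII] Cor. 3.12.

**RIDER (doc-only v2, after abc-iut-w5-d174's `PSCOriginVertexGrowth.lean`, p451029).**  At every
origin all of whose data have `i = 2` and which is inhabited on a profinite group — in particular at
the `Ω_tc'` exported here — the displayed hypotheses `RestrictBDOfPSCTypeHolds Ω` (finite étale
coverings of `Ω`-data are `Ω`-data) and `OpenInterDeterminesComponentHolds Ω` (F-0459) are JOINTLY
UNSATISFIABLE (coverings of a two-vertex datum satisfying Prop. 1.2 (i) have unboundedly many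
vertices).  Hence BOTH implication conjuncts of `generalSigma_nonVacuity` are VACUOUS AS TYPED
(witnessed ≠ inhabited); what this file establishes is the SCOPE conjunct `generalSigma_scope_inhabited`
(the non-origin binders of the general-`Σ` kernels — `l ∈ Σ_G ∩ Σ_H` with `Σ ⊋ {l}`, two vertices,
sturdiness, `hprof` — are simultaneously realised by genuine data).  A non-vacuous multi-vertex
instance of the thirteen-input kernels requires a COVERING-CLOSED multi-vertex origin (data with
unboundedly many vertices: the pointed-stable-curve bridge), which the tree does not yet have; the only
origin of record where all inputs are jointly witnessed is the one-vertex `Ω_scg`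
(`PSCSmoothCurveGenuineOrigin.lean`), where (ii)/(iii) are degenerate.
-/

noncomputable section

namespace Literature.AnabelianGeometry.SemiGraphs

open SemiGraphOfAnabelioids (IsProSigmaCompletion)
open Literature.GroupTheory.CombinatorialGroupTheory

namespace PSCDatum

/-- **The scope of the general-`Σ` theorems is inhabited by genuine data.**  There is an origin `Ω`
(data of two-component shape on profinite groups, in the displayed form of
`exists_twoComponentOrigin_holds`) such that (a) every `Ω`-datum lives on a profinite group (the
displayed `hprof` of the Thm. 1.6 kernels) and has `i = 2`, `n = 1`, `r = 0`; (b) `Ω` contains a STURDY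
datum with `Σ = {2, 3}` — two primes, two vertices of genus `2`, one node.
[cite: MochizukiCombGC2007, Def 1.1 p.6] -/
theorem generalSigma_scope_inhabited :
    ∃ Ω : PSCOrigin.{0},
      (∀ ⦃Q : Type⦄ [Group Q] [TopologicalSpace Q] [IsTopologicalGroup Q] (K : PSCDatum Q),
          Ω.IsOfPSCType K → CompactSpace Q ∧ TotallyDisconnectedSpace Q) ∧
      (∀ ⦃Q : Type⦄ [Group Q] [TopologicalSpace Q] [IsTopologicalGroup Q] (K : PSCDatum Q),
          Ω.IsOfPSCType K → K.graph.i = 2 ∧ K.graph.n = 1 ∧ K.graph.r = 0) ∧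
      ∃ (Q : ProfiniteGrp.{0}) (G : PSCDatum Q),
        Ω.IsOfPSCType G ∧ G.Sigma = {2, 3} ∧ G.graph.i = 2 ∧ G.graph.n = 1 ∧ G.graph.r = 0 ∧
          G.IsSturdy := by
  classical
  -- the origin: data of two-component shape on profinite groups, displayed form of f-165's inhabitant
  let Ω : PSCOrigin.{0} :=
    ⟨fun {Q} _ _ K => ∃ (_ : IsTopologicalGroup Q), CompactSpace Q ∧ TotallyDisconnectedSpace Q ∧
      K.graph.i = 2 ∧ K.graph.n = 1 ∧ K.graph.r = 0 ∧
      ∃ (g₁ g₂ : ℕ) (ι : PuncturedSurfaceGroup (g₁ + g₂) 0 →* Q), 0 < g₁ ∧ 0 < g₂ ∧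
        IsProSigmaCompletion K.Sigma ι ∧
        ∃ v₀ v₁ : K.graph.V, v₀ ≠ v₁ ∧ K.genus v₀ = g₁ ∧ K.genus v₁ = g₂ ∧
          K.vertGp v₀ = ((Subgroup.closure
            (Set.range (fun i : Fin g₁ => PuncturedSurfaceGroup.a (r := 0) (Fin.castAdd g₂ i)) ∪
              Set.range (fun i : Fin g₁ => PuncturedSurfaceGroup.b (r := 0) (Fin.castAdd g₂ i)))).map
                ι).topologicalClosure ∧
          K.vertGp v₁ = ((Subgroup.closure
            (Set.range (fun j : Fin g₂ => PuncturedSurfaceGroup.a (r := 0) (Fin.natAdd g₁ j)) ∪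
              Set.range (fun j : Fin g₂ => PuncturedSurfaceGroup.b (r := 0) (Fin.natAdd g₁ j)))).map
                ι).topologicalClosure ∧
          ∀ e, K.graph.nodeEnds e = s(v₀, v₁) ∧
            K.nodeGp e = ((Subgroup.zpowers (List.ofFn fun i : Fin g₁ =>
              PuncturedSurfaceGroup.a (g := g₁ + g₂) (r := 0) (Fin.castAdd g₂ i) *
                PuncturedSurfaceGroup.b (Fin.castAdd g₂ i) *
                  (PuncturedSurfaceGroup.a (Fin.castAdd g₂ i))⁻¹ *
                    (PuncturedSurfaceGroup.b (Fin.castAdd g₂ i))⁻¹).prod).map ι).topologicalClosure⟩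
  refine ⟨Ω, ?_, ?_, ?_⟩
  · intro Q _ _ _ K hK
    obtain ⟨_, hc, ht, -⟩ := hK
    exact ⟨hc, ht⟩
  · intro Q _ _ _ K hK
    obtain ⟨_, -, -, hi, hn, hr, -⟩ := hK
    exact ⟨hi, hn, hr⟩
  · -- the inhabitant: f-165's datum over a pro-{2,3} completion of `Γ_{4,0}`, genera (2, 2)
    obtain ⟨_, hinh, -⟩ := exists_twoComponentOrigin_holds
    have hS : ({2, 3} : Set ℕ).Nonempty := ⟨2, by simp⟩
    have hP : ∀ p ∈ ({2, 3} : Set ℕ), p.Prime := by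
      intro p hp
      simp only [Set.mem_insert_iff, Set.mem_singleton_iff] at hp
      rcases hp with rfl | rfl
      exacts [Nat.prime_two, Nat.prime_three]
    obtain ⟨Q, ι, G, hι, -, hSig, hi, hn, hr, ⟨v₀, v₁, hne, hg₀, hg₁, hV₀, hV₁, hN⟩, hst⟩ :=
      hinh {2, 3} hS hP 2 2 (by norm_num) (by norm_num)
    refine ⟨Q, G, ?_, hSig, hi, hn, hr, hst le_rfl le_rfl⟩
    exact ⟨inferInstance, inferInstance, inferInstance, hi, hn, hr, 2, 2, ι, by norm_num, by norm_num,
      hSig ▸ hι, v₀, v₁, hne, hg₀, hg₁, hV₀, hV₁, hN⟩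

/-- **Non-vacuity of the general-`Σ` Theorem 1.6 (ii)(iii) kernels** (cell row «PSC-NV-Σ»).  At the
origin and the STURDY two-vertex datum `G` with `Σ_G = {2, 3}` of `generalSigma_scope_inhabited`, the
general-`Σ` kernels instantiate BY NAME: modulo the named origin statements at `Ω` (displayed as
hypotheses — exactly the inputs of `unrVerticialIffHolds_of_inputs''` resp.
`graphicIffFiltrationPreservingHolds_of_inputs''`; the displayed profiniteness `hprof` is DISCHARGED at
this `Ω`), (iii) every `β : Π^unr_G ≃ Π^unr_G` is verticially filtration-preserving iff
group-theoretically verticial — a genuine `↔`, sturdiness being discharged — and (ii) every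
`α : Π_G ≃ Π_G` is graphic iff graphically filtration-preserving.  Both `2` and `3` serve as the common
prime `l ∈ Σ_G ∩ Σ_H` of the `Σ = {l}` reduction (p. 13, proof of (i); p. 14 for (ii)/(iii)).
Non-vacuity / consistency evidence; not the
printed theorem for all pointed stable curves.  RIDER (v2): the hypotheses `RestrictBDOfPSCTypeHolds Ω`
and `OpenInterDeterminesComponentHolds Ω` displayed in the two implication conjuncts are jointly
unsatisfiable at this `Ω` (abc-iut-w5-d174, `PSCOriginVertexGrowth.lean`), so those two conjuncts are
vacuous as typed; the substantive content is the scope conjunct (see the module docstring).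
[cite: MochizukiCombGC2007, Thm 1.6 p.13] -/
theorem generalSigma_nonVacuity :
    ∃ (Ω : PSCOrigin.{0}) (Q : ProfiniteGrp.{0}) (G : PSCDatum Q),
      Ω.IsOfPSCType G ∧ G.Sigma = {2, 3} ∧ 2 ∈ G.Sigma ∧ 3 ∈ G.Sigma ∧ G.graph.i = 2 ∧
        G.graph.n = 1 ∧ G.IsSturdy ∧
      (∀ ⦃R : Type⦄ [Group R] [TopologicalSpace R] [IsTopologicalGroup R] (K : PSCDatum R),
          Ω.IsOfPSCType K → CompactSpace R ∧ TotallyDisconnectedSpace R) ∧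
      (RankStatementsHold Ω → VertCountLeNodeCountSuccHolds Ω → UnrVerticialCharacterizationHolds' Ω →
        UnrVertAbOfRankHolds Ω → RestrictBDOfPSCTypeHolds Ω → MapAlongProLOfPSCTypeHolds Ω →
        OpenInterDeterminesComponentHolds Ω →
          ∀ β : (Q ⧸ G.unrKer) ≃ₜ* (Q ⧸ G.unrKer),
            G.IsUnrVerticiallyFiltrationPreserving G β ↔ G.IsUnrGroupTheoreticallyVerticial G β) ∧
      (RankStatementsHold Ω → CuspidalEdgeLikeCharacterizationHolds Ω →
        NodalEdgeLikeCharacterizationHolds Ω → CompactifyOfPSCTypeHolds Ω →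
        RestrictBDOfPSCTypeHolds Ω → SturdyCoverHolds Ω → OpenInterDeterminesComponentHolds Ω →
        CommensurableTerminalityHolds Ω → GraphicIffEdgeLikeVerticialHolds Ω →
        UnrVerticialCharacterizationHolds' Ω → UnrVertAbOfRankHolds Ω →
        VertCountLeNodeCountSuccHolds Ω → MapAlongProLOfPSCTypeHolds Ω →
          ∀ α : (Q : Type) ≃ₜ* Q, G.IsGraphic G α ↔ G.IsGraphicallyFiltrationPreserving G α) := by
  obtain ⟨Ω, hprof, -, Q, G, hG, hSig, hi, hn, -, hst⟩ := generalSigma_scope_inhabited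
  refine ⟨Ω, Q, G, hG, hSig, by simp [hSig], by simp [hSig], hi, hn, hst, hprof, ?_, ?_⟩
  · intro hrank hconn hunr hrankv hres hmap h12 β
    exact unrVerticialIffHolds_of_inputs'' Ω hprof hrank hconn hunr hrankv hres hmap h12 G G β hG hG
      hst hst
  · intro hrank hcusp hnodal hcpt hres hcover hopen hCT hP15 hunr hrankv hconn hmap α
    exact graphicIffFiltrationPreservingHolds_of_inputs'' Ω hprof hrank hcusp hnodal hcpt hres hcover
      hopen hCT hP15 hunr hrankv hconn hmap G G α hG hG

end PSCDatum

end Literature.AnabelianGeometry.SemiGraphs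

end
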